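import Literature.AlgebraicGeometry.Frobenioids.PadicKummerGaloisFN
import Literature.AnabelianGeometry.AbsoluteAnabelian.MLFGaloisModel
import HarnessLib

/-!
# Frobenioids II, Definition 2.2 / Remark 2.2.1: the arithmetic monoids `O^⊳_L`, `O^×_L` and the
# zero-parameter context of a local field

Mochizuki, *The geometry of Frobenioids II*, Kyushu J. Math. **62** (2008) 401–460, §2, Definition
2.2 (i)–(iii) pp. 17–18, Remark 2.2.1 p. 18 [cite: MochizukiFrdII2008, Rmk 2.2.1 p.18]: "In the
notation of Definition 2.2, suppose that `A` is `(N,H)`-saturated. Write `A_E = Spec(L)` [so `L`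
is a finite extension of `K`]. Note that `H_A` acts naturally on `L`, `O^□(A)`. Moreover, we have a
natural isomorphism `(O^□(A) ⊇) O^□(A)^H ⥲ O^□(L^H)`" — with `O^□ = O^⊳` (nonzero integers) if
`Φ` is fieldwise saturated and `O^□ = O^×` (units) otherwise (Def. 2.2 (iii)); for the `p`-adic
Frobenioid, `O^⊳(A) ≅ O^⊳_L`, `O^×(A) ≅ O^×_L` ([FrdII] Thm. 1.2 (i); abc-iut-L1-d10's
`nonempty_unitsSubgroup_mulEquiv_unitSubgroup`).

This file supplies the ARITHMETIC MONOIDS of that remark and plugs them into the Galois-level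
context of `PadicKummerGalois.lean`, so that Definition 2.2 has a ZERO-PARAMETER instance for
every finite Galois `L ⊆ K̄` over a field `K` and open normal `H ⊆ G_K`:
* `GalMonoid L S` — a `Gal(L/K)`-stable submonoid `S ⊆ L` avoiding `0`, as a cancellative
  commutative monoid with its `Gal(L/K)`-action (type synonym of `↥S`);
* `triSubmonoid K L = O^⊳_L`, `unitsSubmonoid' K L = O^×_L` — REUSING abc-iut-L4-t2's
  `nonzeroIntegers` / `unitSubmonoid` ([AbsTopIII] Def. 3.1 (i), `MLFGaloisModel.lean`: elements of
  `L` integral over `𝒪_K`, nonzero / invertible there), one notion of `O^⊳` across L1/L4, and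
  Def. 2.2 (iii)'s `boxSubmonoid fs` (`O^⊳_L` if `fs`, else `O^×_L`);
* `Def22Context.ofLocalField` — the context with `O^□(A) := O^□_L`, `Aut_C(A) ↠ G_A ≅ Gal(L/K)`
  divided out (`ofGaloisQuot`);
* `muModelOfSubmonoid` — its `MuModel` (the `G_K`-equivariant `μ_N(O^□_L) ≅ μ_N(K̄)`) when
  `μ_N(K̄) ⊆ L` ("`A` is `μ_N`-saturated"), whence `isMuSaturated_galMonoid` (Def. 2.1 (i) at the
  model) and `nonempty_fn_equiv_zmod_ofLocalField` (`F_N(A) ≅ ℤ/Nℤ` at the model, from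
  `PadicKummerGaloisFN`).
Nothing here concerns [IUTchIII]; classical algebraic number theory. Universe `0`.
-/

noncomputable section

namespace Literature.AlgebraicGeometry.Frobenioids

namespace PadicKummer

open Field IntermediateField
open scoped ValuativeRel
open Literature.NumberTheory.GaloisRepresentations
open Literature.NumberTheory.GaloisRepresentations.LocalWeilDatum
open Literature.NumberTheory.GaloisRepresentations.DiscreteGaloisModule
open Literature.AnabelianGeometry.AbsoluteAnabelian (nonzeroIntegers unitSubmonoid integersClosure
  smul_mem_nonzeroIntegers smul_mem_unitSubmonoid unitSubmonoid_le_nonzeroIntegers)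

variable {K : Type} [Field K] (L : IntermediateField K (AlgebraicClosure K))

/-! ### `Gal(L/K)`-stable submonoids of `L` as monoids with action -/

/-- The data of a `Gal(L/K)`-stable submonoid of `L` not containing `0` (so cancellative): the
shape of `O^⊳_L`, `O^×_L` on which "`H_A` acts naturally" (FrdII Rmk. 2.2.1, p. 18).
[cite: MochizukiFrdII2008, Rmk 2.2.1 p.18] -/
structure StableSubmonoid : Type where
  /-- the underlying submonoid of `L` -/
  toSubmonoid : Submonoid L
  /-- stability under `Gal(L/K)` -/
  smul_mem : ∀ (σ : L ≃ₐ[K] L) {x : L}, x ∈ toSubmonoid → σ • x ∈ toSubmonoid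
  /-- `0 ∉ S` -/
  zero_not_mem : (0 : L) ∉ toSubmonoid

variable {L}

/-- The monoid `↥S` of a stable submonoid, as a type carrying the `Gal(L/K)`-action (a synonym, so
that the action instance does not apply to every `↥S`). [cite: MochizukiFrdII2008, Rmk 2.2.1 p.18] -/
def GalMonoid (S : StableSubmonoid L) : Type := ↥S.toSubmonoid

namespace GalMonoid

variable (S : StableSubmonoid L)

/-- `O^□_L` is a commutative monoid (the submonoid structure). [cite: MochizukiFrdII2008, Rmk 2.2.1 p.18] -/
instance instCommMonoid : CommMonoid (GalMonoid S) := inferInstanceAs (CommMonoid ↥S.toSubmonoid)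

/-- The inclusion `O^□_L ⊆ L`. [cite: MochizukiFrdII2008, Rmk 2.2.1 p.18] -/
def val (x : GalMonoid S) : L := (show ↥S.toSubmonoid from x).1

variable {S}

/-- Elements of `GalMonoid S` lie in `S`. [cite: MochizukiFrdII2008, Rmk 2.2.1 p.18] -/
theorem val_mem (x : GalMonoid S) : x.val ∈ S.toSubmonoid := (show ↥S.toSubmonoid from x).2

/-- Elements are determined by their value in `L`. [cite: MochizukiFrdII2008, Rmk 2.2.1 p.18] -/
@[ext] theorem ext {x y : GalMonoid S} (h : x.val = y.val) : x = y := Subtype.ext h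

/-- Constructor. [cite: MochizukiFrdII2008, Rmk 2.2.1 p.18] -/
def mk (x : L) (hx : x ∈ S.toSubmonoid) : GalMonoid S := show ↥S.toSubmonoid from ⟨x, hx⟩

/-- `val` of `mk`. [cite: MochizukiFrdII2008, Rmk 2.2.1 p.18] -/
@[simp] theorem val_mk (x : L) (hx : x ∈ S.toSubmonoid) : (mk x hx : GalMonoid S).val = x := rfl

/-- `val` is multiplicative. [cite: MochizukiFrdII2008, Rmk 2.2.1 p.18] -/
@[simp] theorem val_mul (x y : GalMonoid S) : (x * y).val = x.val * y.val := rfl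

/-- `val 1 = 1`. [cite: MochizukiFrdII2008, Rmk 2.2.1 p.18] -/
@[simp] theorem val_one : (1 : GalMonoid S).val = 1 := rfl

/-- Elements of `O^□_L` are nonzero in `L`. [cite: MochizukiFrdII2008, Rmk 2.2.1 p.18] -/
theorem val_ne_zero (x : GalMonoid S) : x.val ≠ 0 := fun h => S.zero_not_mem (h ▸ x.val_mem)

variable (S)

/-- `O^□_L` is cancellative (it avoids `0` in the field `L`). [cite: MochizukiFrdII2008, Rmk 2.2.1 p.18] -/
instance instIsCancelMul : IsCancelMul (GalMonoid S) where
  mul_left_cancel a b c h := ext (mul_left_cancel₀ (val_ne_zero a) (by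
    simpa only [val_mul] using congrArg (fun z : GalMonoid S => z.val) h))
  mul_right_cancel a b c h := ext (mul_right_cancel₀ (val_ne_zero a) (by
    simpa only [val_mul] using congrArg (fun z : GalMonoid S => z.val) h))

/-- "`H_A` acts naturally on `L`, `O^□(A)`" (FrdII Rmk. 2.2.1 p. 18): the action of `Gal(L/K)` on the
stable submonoid, by monoid automorphisms. [cite: MochizukiFrdII2008, Rmk 2.2.1 p.18] -/
instance instMulDistribMulAction : MulDistribMulAction (L ≃ₐ[K] L) (GalMonoid S) where
  smul σ x := mk (σ • x.val) (S.smul_mem σ x.val_mem)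
  one_smul x := ext (one_smul _ x.val)
  mul_smul σ τ x := ext (mul_smul σ τ x.val)
  smul_mul σ x y := ext (by
    change σ • (x * y).val = σ • x.val * σ • y.val
    rw [val_mul, smul_mul'])
  smul_one σ := ext (by change σ • (1 : GalMonoid S).val = 1; rw [val_one, smul_one])

variable {S}

/-- The action on values: `(σ • x).val = σ (x.val)`. [cite: MochizukiFrdII2008, Rmk 2.2.1 p.18] -/
@[simp] theorem val_smul (σ : L ≃ₐ[K] L) (x : GalMonoid S) : (σ • x).val = σ • x.val := rfl

variable (S)

/-- The `G_K`-equivariant embedding `O^□_L ⊆ L ⊆ K̄` (the `ι` of `MuModel.ofMonoidHom`).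
[cite: MochizukiFrdII2008, Rmk 2.2.1 p.18] -/
def toClosure : GalMonoid S →* AlgebraicClosure K where
  toFun x := ((x.val : L) : AlgebraicClosure K)
  map_one' := by rw [val_one]; rfl
  map_mul' _ _ := by rw [val_mul]; rfl

/-- `toClosure` on elements. [cite: MochizukiFrdII2008, Rmk 2.2.1 p.18] -/
@[simp] theorem toClosure_apply (x : GalMonoid S) : toClosure S x = ((x.val : L) : AlgebraicClosure K) :=
  rfl

/-- `O^□_L ↪ K̄` is injective. [cite: MochizukiFrdII2008, Rmk 2.2.1 p.18] -/
theorem toClosure_injective : Function.Injective (toClosure S) := fun _ _ h =>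
  ext (Subtype.ext h)

variable [Normal K L]

/-- `O^□_L ↪ K̄` is `G_K`-equivariant for the action through `G_K ↠ Gal(L/K)`.
[cite: MochizukiFrdII2008, Rmk 2.2.1 p.18] -/
theorem toClosure_smul (σ : absoluteGaloisGroup K) (x : GalMonoid S) :
    toClosure S (resGal L σ • x) = σ • toClosure S x := by
  rw [toClosure_apply, val_smul, toClosure_apply, AlgEquiv.smul_def, coe_resGal_apply]

end GalMonoid

/-! ### `O^⊳_L`, `O^×_L` and Definition 2.2 (iii) -/

section Arithmetic

variable (K) [ValuativeRel K] (L)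

/-- `O^⊳_L`: the nonzero elements of `L` integral over `𝒪_K` — abc-iut-L4-t2's `nonzeroIntegers`
([AbsTopIII] Def. 3.1 (i)) for the `K`-algebra `L` — as a `Gal(L/K)`-stable submonoid ("`O^□(−) :=
O^⊳(−)` if `Φ` is fieldwise saturated", Def. 2.2 (iii)). [cite: MochizukiFrdII2008, Def 2.2 (iii) p.18] -/
def triSubmonoid : StableSubmonoid L where
  toSubmonoid := nonzeroIntegers K L
  smul_mem σ _ hx := smul_mem_nonzeroIntegers σ hx
  zero_not_mem h := h.2 rfl

/-- `O^×_L`: the elements of `L` integral over `𝒪_K` and invertible there — abc-iut-L4-t2's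
`unitSubmonoid` — as a `Gal(L/K)`-stable submonoid ("`O^□(−) := O^×(−)` if `Φ` is not fieldwise
saturated", Def. 2.2 (iii)). [cite: MochizukiFrdII2008, Def 2.2 (iii) p.18] -/
def unitsStableSubmonoid : StableSubmonoid L where
  toSubmonoid := unitSubmonoid K L
  smul_mem σ _ hx := smul_mem_unitSubmonoid σ hx
  zero_not_mem h := (unitSubmonoid_le_nonzeroIntegers h).2 rfl

/-- **Definition 2.2 (iii)** at the arithmetic level (FrdII p. 18): `O^□_L := O^⊳_L` if `Φ` is
fieldwise saturated, `O^□_L := O^×_L` otherwise. [cite: MochizukiFrdII2008, Def 2.2 (iii) p.18] -/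
def boxStableSubmonoid (fieldwiseSaturated : Prop) : StableSubmonoid L := by
  classical exact if fieldwiseSaturated then triSubmonoid K L else unitsStableSubmonoid K L

/-- `O^×_L ⊆ O^⊳_L`. [cite: MochizukiFrdII2008, Def 2.2 (iii) p.18] -/
theorem unitsStableSubmonoid_le_triSubmonoid :
    (unitsStableSubmonoid K L).toSubmonoid ≤ (triSubmonoid K L).toSubmonoid :=
  unitSubmonoid_le_nonzeroIntegers

/-- `O^×_L` is exactly the group of units of the monoid `O^⊳_L` (consistency with
`PadicKummerSetting.OBox`, which takes `O^×` as `IsUnit.submonoid O^⊳`).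
[cite: MochizukiFrdII2008, Def 2.2 (iii) p.18] -/
theorem isUnit_triSubmonoid_iff (x : GalMonoid (triSubmonoid K L)) :
    IsUnit x ↔ x.val ∈ unitSubmonoid K L := by
  constructor
  · rintro ⟨u, rfl⟩
    have h1 := GalMonoid.val_mem (S := triSubmonoid K L) (u : GalMonoid (triSubmonoid K L))
    have h2 := GalMonoid.val_mem (S := triSubmonoid K L) (↑u⁻¹ : GalMonoid (triSubmonoid K L))
    refine ⟨h1.1, (↑u⁻¹ : GalMonoid (triSubmonoid K L)).val, h2.1, ?_⟩
    rw [← GalMonoid.val_mul, Units.mul_inv, GalMonoid.val_one]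
  · rintro ⟨_, y, hy, hxy⟩
    have hy0 : y ≠ 0 := fun h => by rw [h, mul_zero] at hxy; exact zero_ne_one hxy
    refine ⟨⟨x, GalMonoid.mk y ⟨hy, hy0⟩, GalMonoid.ext (by rw [GalMonoid.val_mul, GalMonoid.val_mk,
      hxy, GalMonoid.val_one]), GalMonoid.ext (by rw [GalMonoid.val_mul, GalMonoid.val_mk, mul_comm,
      hxy, GalMonoid.val_one])⟩, rfl⟩

end Arithmetic

/-! ### The zero-parameter context of Definition 2.2 -/

namespace Def22Context

variable (L) [Normal K L] [FiniteDimensional K L]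
  (H : Subgroup (absoluteGaloisGroup K)) [H.Normal] (hH : IsOpen (H : Set (absoluteGaloisGroup K)))
  (S : StableSubmonoid L)

/-- **Definition 2.2, the arithmetic context** (FrdII pp. 17–18): `G := G_K`, `H`, `A_E = Spec L`,
`Aut_E(A_E) = Gal(L/K) ≅ G_A` (the quotient `Aut_C(A) ↠ G_A` divided out), `O^□(A) := O^□_L` a
`Gal(L/K)`-stable submonoid of `L` (`triSubmonoid` / `unitsStableSubmonoid` / `boxStableSubmonoid`).
No parameters remain beyond `(K, L, H, O^□_L)`. [cite: MochizukiFrdII2008, Def 2.2 (i) p.17] -/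
abbrev ofLocalField : Def22Context := ofGaloisQuot L H hH (GalMonoid S)

/-- `O^□(A) = O^□_L`. [cite: MochizukiFrdII2008, Def 2.2 (iii) p.18] -/
theorem O_ofLocalField : (ofLocalField L H hH S).O = GalMonoid S := rfl

/-- For the arithmetic context "`G_A ↪ Aut_E(A_E)` is an isomorphism" holds.
[cite: MochizukiFrdII2008, Def 2.2 (i) p.17] -/
theorem galoisSurjective_ofLocalField : (ofLocalField L H hH S).GaloisSurjective :=
  galoisSurjective_ofGaloisQuot L H hH (GalMonoid S)

/-- **Remark 2.2.1** (FrdII p. 18), the invariants: `f ∈ O^□(A)^H` iff `σ(f) = f` in `L` for all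
`σ ∈ H` (through `G_K ↠ Gal(L/K)`), i.e. `O^□(A)^H = O^□_L ∩ L^{H_A} = O^□(L^H)`.
[cite: MochizukiFrdII2008, Rmk 2.2.1 p.18] -/
theorem mem_invariantsSubmonoid_ofLocalField_iff (f : GalMonoid S) :
    f ∈ Kummer.invariantsSubmonoid (GalMonoid S) (ofLocalField L H hH S).HA ↔
      ∀ σ ∈ H, resGal L σ • f.val = f.val := by
  rw [mem_invariantsSubmonoid_ofGalois_iff]
  refine forall_congr' fun σ => forall_congr' fun _ => ?_
  rw [GalMonoid.ext_iff, GalMonoid.val_smul]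

end Def22Context

/-! ### `μ_N`-saturation and `F_N(A) ≅ ℤ/Nℤ` at the arithmetic context -/

section Mu

variable (L) [Normal K L] (S : StableSubmonoid L) (N : ℕ)

omit [Normal K L] in
/-- The roots of unity of `K̄` that lie in `L` give units of `O^□_L`, provided `O^□_L` contains
every element of `L` with `x^N = 1` (true for `O^⊳_L`, `O^×_L`: roots of unity are integral units).
Hypothesis shape for `MuModel.ofMonoidHom`. [cite: MochizukiFrdII2008, Def 2.1 (i) p.16] -/
theorem exists_unit_of_rootsOfUnity_mem
    (hS : ∀ x : L, x ^ N = 1 → x ∈ S.toSubmonoid) (hN : 0 < N)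
    (hμ : ∀ ζ : rootsOfUnity N (AlgebraicClosure K), ((ζ : (AlgebraicClosure K)ˣ) : AlgebraicClosure K) ∈ L)
    (ζ : rootsOfUnity N (AlgebraicClosure K)) :
    ∃ u : (GalMonoid S)ˣ, GalMonoid.toClosure S (u : GalMonoid S) =
      ((ζ : (AlgebraicClosure K)ˣ) : AlgebraicClosure K) := by
  set z : L := ⟨((ζ : (AlgebraicClosure K)ˣ) : AlgebraicClosure K), hμ ζ⟩ with hz
  have hzN : z ^ N = 1 := by
    apply Subtype.ext
    change (((ζ : (AlgebraicClosure K)ˣ) : AlgebraicClosure K)) ^ N = 1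
    rw [← Units.val_pow_eq_pow_val, (mem_rootsOfUnity N (ζ : (AlgebraicClosure K)ˣ)).mp ζ.2,
      Units.val_one]
  have hzN' : (z ^ (N - 1)) ^ N = 1 := by rw [← pow_mul, mul_comm, pow_mul, hzN, one_pow]
  have hmul : z * z ^ (N - 1) = 1 := by
    rw [← pow_succ', Nat.sub_add_cancel (Nat.one_le_iff_ne_zero.mpr hN.ne'), hzN]
  refine ⟨⟨GalMonoid.mk z (hS z hzN), GalMonoid.mk (z ^ (N - 1)) (hS _ hzN'),
    GalMonoid.ext (by rw [GalMonoid.val_mul, GalMonoid.val_mk, GalMonoid.val_mk, hmul,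
      GalMonoid.val_one]),
    GalMonoid.ext (by rw [GalMonoid.val_mul, GalMonoid.val_mk, GalMonoid.val_mk, mul_comm, hmul,
      GalMonoid.val_one])⟩, rfl⟩

/-- The `MuModel` of the arithmetic context: `μ_N(O^□_L) ≅ μ_N(K̄)`, `G_K`-equivariantly, as soon
as `μ_N(K̄) ⊆ L` and `O^□_L` contains the `N`-th roots of unity of `L`.
[cite: MochizukiFrdII2008, Def 2.2 (ii) p.18] -/
def muModelOfSubmonoid (hS : ∀ x : L, x ^ N = 1 → x ∈ S.toSubmonoid) (hN : 0 < N)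
    (hμ : ∀ ζ : rootsOfUnity N (AlgebraicClosure K),
      ((ζ : (AlgebraicClosure K)ˣ) : AlgebraicClosure K) ∈ L) :
    Def22Context.MuModel L (GalMonoid S) N :=
  Def22Context.MuModel.ofMonoidHom (GalMonoid.toClosure S) (GalMonoid.toClosure_injective S)
    (GalMonoid.toClosure_smul S) (exists_unit_of_rootsOfUnity_mem L S N hS hN hμ)

/-- **Definition 2.1 (i) at the model**: if `μ_N(K̄) ⊆ L` and `O^□_L` contains the `N`-th roots of
unity of `L`, then `μ_N(O^□_L) ≅ ℤ/Nℤ` ("`A` is `μ_N`-saturated"), `K̄` having exactly `N` `N`-th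
roots of unity (the tree's `muEquivZMod`). [cite: MochizukiFrdII2008, Def 2.1 (i) p.16] -/
theorem isMuSaturated_galMonoid [CharZero K] [NeZero N] (hS : ∀ x : L, x ^ N = 1 → x ∈ S.toSubmonoid)
    (hμ : ∀ ζ : rootsOfUnity N (AlgebraicClosure K),
      ((ζ : (AlgebraicClosure K)ˣ) : AlgebraicClosure K) ∈ L) :
    Kummer.IsMuSaturated N (GalMonoid S) :=
  ⟨⟨(muModelOfSubmonoid L S N hS (NeZero.pos N) hμ).toMulEquiv.trans
    (AddEquiv.toMultiplicativeRight
      ((MuCarrier.toAdditive (K := K) (n := N)).symm.trans (muEquivZMod K N)))⟩⟩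

variable (K) [ValuativeRel K]

omit [Normal K L] in
/-- Roots of unity of `L` lie in `O^⊳_L` (they are integral over `ℤ`, hence over `𝒪_K`, and nonzero).
[cite: MochizukiFrdII2008, Def 2.1 (i) p.16] -/
theorem mem_triSubmonoid_of_pow_eq_one {x : L} (hN : 0 < N) (hx : x ^ N = 1) :
    x ∈ (triSubmonoid K L).toSubmonoid := by
  refine ⟨?_, fun h => ?_⟩
  · have h1 : IsIntegral 𝒪[K] (x ^ N) := by rw [hx]; exact isIntegral_one
    exact IsIntegral.of_pow hN h1
  · rw [h, zero_pow hN.ne'] at hx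
    exact zero_ne_one hx

omit [Normal K L] in
/-- Roots of unity of `L` lie in `O^×_L`. [cite: MochizukiFrdII2008, Def 2.1 (i) p.16] -/
theorem mem_unitsStableSubmonoid_of_pow_eq_one {x : L} (hN : 0 < N) (hx : x ^ N = 1) :
    x ∈ (unitsStableSubmonoid K L).toSubmonoid := by
  refine ⟨(mem_triSubmonoid_of_pow_eq_one K L N hN hx).1, x ^ (N - 1),
    (mem_triSubmonoid_of_pow_eq_one K L N hN (x := x ^ (N - 1))
      (by rw [← pow_mul, mul_comm, pow_mul, hx, one_pow])).1, ?_⟩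
  rw [← pow_succ', Nat.sub_add_cancel (Nat.one_le_iff_ne_zero.mpr hN.ne'), hx]

omit [Normal K L] in
/-- Roots of unity of `L` lie in `O^□_L` for either choice of Def. 2.2 (iii).
[cite: MochizukiFrdII2008, Def 2.2 (iii) p.18] -/
theorem mem_boxStableSubmonoid_of_pow_eq_one (fs : Prop) {x : L} (hN : 0 < N) (hx : x ^ N = 1) :
    x ∈ (boxStableSubmonoid K L fs).toSubmonoid := by
  unfold boxStableSubmonoid
  split_ifs
  · exact mem_triSubmonoid_of_pow_eq_one K L N hN hx
  · exact mem_unitsStableSubmonoid_of_pow_eq_one K L N hN hx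

/-- The `MuModel` of `O^□_L` (Def. 2.2 (iii)) when `μ_N(K̄) ⊆ L`. [cite: MochizukiFrdII2008, Def 2.2 (ii) p.18] -/
def muModelBox (fs : Prop) (hN : 0 < N)
    (hμ : ∀ ζ : rootsOfUnity N (AlgebraicClosure K),
      ((ζ : (AlgebraicClosure K)ˣ) : AlgebraicClosure K) ∈ L) :
    Def22Context.MuModel L (GalMonoid (boxStableSubmonoid K L fs)) N :=
  muModelOfSubmonoid L _ N (fun _ hx => mem_boxStableSubmonoid_of_pow_eq_one K L N fs hN hx) hN hμ

end Mu

/-! ### Consequences for a non-archimedean local field `K` of characteristic `0` -/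

section Local

variable (L) [Normal K L] [FiniteDimensional K L]
  (H : Subgroup (absoluteGaloisGroup K)) [H.Normal] (hH : IsOpen (H : Set (absoluteGaloisGroup K)))
  (S : StableSubmonoid L) (N : ℕ) [NeZero N]
  [ValuativeRel K] [TopologicalSpace K] [IsNonarchimedeanLocalField K] [CharZero K]

/-- **"`F_N(A) ≅ ℤ/Nℤ`" at the arithmetic context** (FrdII Def. 2.2 (ii) p. 18): for `K` a
non-archimedean local field of characteristic `0`, `μ_N(K̄) ⊆ L`, `O^□_L ∋` the roots of unity of
`L`, and an `(N, H)`-saturated `A`, `F_N(A) ≃+ ℤ/Nℤ`. [cite: MochizukiFrdII2008, Def 2.2 (ii) p.18] -/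
theorem nonempty_fn_equiv_zmod_ofLocalField (hS : ∀ x : L, x ^ N = 1 → x ∈ S.toSubmonoid)
    (hμ : ∀ ζ : rootsOfUnity N (AlgebraicClosure K),
      ((ζ : (AlgebraicClosure K)ˣ) : AlgebraicClosure K) ∈ L)
    (h : IsNHSaturated (Def22Context.ofLocalField L H hH S) N) :
    Nonempty (FN (Def22Context.ofLocalField L H hH S) N ≃+ ZMod N) :=
  Def22Context.nonempty_fn_equiv_zmod_ofGalois L (GalMonoid S) H hH (MonoidHom.id _) (fun _ _ => rfl)
    (muModelOfSubmonoid L S N hS (NeZero.pos N) hμ) h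

end Local

end PadicKummer

end Literature.AlgebraicGeometry.Frobenioids

end
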